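import Summits.ResolutionOfSingularities.ResolutionOfSingularities.Theorems.EquisingularLiftEquisingularLiftNatExactShadowCJSThree
import Summits.ResolutionOfSingularities.ResolutionOfSingularities.Theorems.EquisingularLiftEquisingularLiftWittRing
import Literature.AlgebraicGeometry.Motives.SmoothHypersurfaceScheme
import Literature.AlgebraicGeometry.Motives.SmoothHypersurfaceIrreducible
import Literature.AlgebraicGeometry.Motives.NonsingularFormIrreducible
import Literature.AlgebraicGeometry.Motives.VarietiesRegularProofs
import Literature.AlgebraicGeometry.Resolution.ComponentGluing
import HarnessLib

/-!
# [OURS · L1 W4.5(b)] EL♮ IN EVERY DIMENSION: the zero-step rung `elNatAt_of_isRegular` and the SMOOTH HYPERSURFACES `V₊(F) ⊂ ℙⁿ⁺¹_K`, all `n ≥ 1`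
# (crux `Theses.EquisingularLift.EquisingularLiftNat` = stmt-ResolutionOfSingularities-20038, the `∀ n` parent)

NOT a statement of any manuscript; OURS kernel theorem (cell `res-hironaka`, chain w45b; seat res-D-pv-013, own initiative, counted 0). AI-written,
weaker than expert review. No definition, no `sorry`, standard axioms.

Every EL♮ specimen in the tree so far lives in `ℙ³` (`n = 3`: quartic, Whitney cubic, cones). The parent crux quantifies over ALL `n`; this file
records the first family of instances of `Theorems.EquisingularLift.ELNatAt p K n H ι` in EVERY ambient dimension — the degenerate but honest case of a
REGULAR `H` (zero blow-ups), by name, and its hypersurface instances: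

* **`elNatAt_of_isRegular`** — `H ⊆ ℙⁿ_K` integral and regular ⇒ `ELNatAt p K n H ι` (tree `elNatOver_of_isRegular` = zero steps of the exact-shadow
  engine, over the Witt ring `stub_wittRing`);
* `HypersurfaceSpecimen.isReduced_hypersurface_of_form`, **`isIntegral_hypersurface_of_prime`** — `V₊(F)` is reduced (by construction) and integral
  for every PRIME form `F ∈ K[x₀,…,x_{n+1}]`, any `n` (generic version of the four per-specimen copies …QuarticForms / …WhitneyCubicForms /
  …FermatConeForms / …ConeForms);
* `HypersurfaceSpecimen.isRegular_hypersurface_of_isNonsingularForm` — a nonsingular form cuts out a regular scheme (tree smoothness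
  `smoothOfRelativeDimension_hypersurface_hom` + `isRegularLocalRing_stalk_of_smoothOfRelativeDimension`);
* **`HypersurfaceSpecimen.elNatAt_smoothHypersurface`** — `ELNatAt p K (n + 1) V₊(F) ι` for every nonsingular form `F` of degree `d ≥ 1` in
  `n + 2 ≥ 3` variables over an algebraically closed `K` of characteristic `p`;
* **`HypersurfaceSpecimen.elNatAt_fermatHypersurface`** — the Fermat hypersurfaces `x₀ᵈ + ⋯ + x_{n+1}ᵈ = 0`, every `n ≥ 1`, every `d` prime to `p`.

References: Hartshorne 1977 I Ex. 5.8, II Ex. 2.9, III Thm. 10.2; Görtz–Wedhorn 6.26; EGA IV 17.5.8.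
-/

set_option linter.dupNamespace false -- mandated namespace `Summit.<Summit>.<Problem>` of this single-conjunct summit

noncomputable section

open CategoryTheory AlgebraicGeometry MvPolynomial
open Literature.AlgebraicGeometry.Resolution
open Literature.AlgebraicGeometry.Motives Literature.AlgebraicGeometry.Motives.SmoothHypersurface
open Summit.ResolutionOfSingularities.ResolutionOfSingularities.Cruxes.EquisingularLift.StrataSplit

namespace Summit.ResolutionOfSingularities.ResolutionOfSingularities.Cruxes.EquisingularLiftNat.Sections

/-! ## The zero-step rung -/

/-- **EL♮ FOR A REGULAR `H`, ANY `n`** (zero blow-ups): `H ⊆ ℙⁿ_K` integral and regular, `K` algebraically closed of characteristic `p`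
⇒ `Theorems.EquisingularLift.ELNatAt p K n H ι` — `elNatOver_of_isRegular` (…ExactShadowCJSThree, unconditional part) over `O = 𝕎(K)`
(`stub_wittRing`). [OURS · L1 W4.5b] [folklore] -/
theorem elNatAt_of_isRegular (p : ℕ) (hp : p.Prime) (K : Type) [Field K] [CharP K p] [IsAlgClosed K] (n : ℕ) (H : Scheme.{0})
    (ι : H ⟶ (projectiveSpace n K).left) [IsClosedImmersion ι] [IsIntegral H] (hH : Scheme.IsRegular H) :
    Theorems.EquisingularLift.ELNatAt p K n H ι := by
  obtain ⟨O, i1, i2, i3, i4, -, -, π, hπ⟩ := stub_wittRing p hp K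
  exact Theorems.EquisingularLift.elNatAt_of_elNatOver hπ (elNatOver_of_isRegular K n H ι hH O π hπ)

namespace HypersurfaceSpecimen

variable (K : Type) [Field K] {n : ℕ}

/-! ## `V₊(F)` for a prime form: reduced, integral — any `n` -/

/-- `V₊(F) ⊂ ℙⁿ⁺¹_K` (the tree's reduced induced `hypersurface F`) is a reduced scheme, for every `F`. [folklore] -/
theorem isReduced_hypersurface_of_form (F : MvPolynomial (Fin (n + 2)) K) : IsReduced (hypersurface F).left :=
  ComponentGluing.isReduced_subscheme_vanishingIdeal (zeroLocusClosed F)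

/-- **`V₊(F)` is an integral scheme for every PRIME form `F ∈ K[x₀,…,x_{n+1}]`**, any `n` (irreducible: tree
`isIrreducible_zeroLocus_of_prime`, Hartshorne II Ex. 2.9; reduced by construction). [cite: Hartshorne1977, II Ex. 2.9] -/
theorem isIntegral_hypersurface_of_prime (F : MvPolynomial (Fin (n + 2)) K) {d : ℕ} (hF : F.IsHomogeneous d) (hFp : Prime F) :
    IsIntegral (hypersurface F).left := by
  haveI := isReduced_hypersurface_of_form K F
  have hirr : IsIrreducible (Set.range (hypersurfaceι F).left) := by
    rw [range_hypersurfaceι]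
    exact isIrreducible_zeroLocus_of_prime _ hF hFp
  haveI : IrreducibleSpace (Set.range (hypersurfaceι F).left) := Subtype.irreducibleSpace hirr
  haveI : IrreducibleSpace (hypersurface F).left :=
    (hypersurfaceι F).left.isClosedEmbedding.isEmbedding.toHomeomorph.irreducibleSpace_iff.mpr this
  exact isIntegral_of_irreducibleSpace_of_isReduced _

/-! ## Nonsingular forms cut out regular schemes -/

/-- **A nonsingular form cuts out a REGULAR scheme**: `IsNonsingularForm K F`, `deg F ≥ 1` ⇒ every local ring of `V₊(F)` is regular
(smooth of relative dimension `n` over `K`, tree `smoothOfRelativeDimension_hypersurface_hom`; smooth over a field ⇒ regular stalks, tree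
`isRegularLocalRing_stalk_of_smoothOfRelativeDimension`). [cite: Hartshorne1977, I Ex. 5.8 and III Thm. 10.2] -/
theorem isRegular_hypersurface_of_isNonsingularForm (F : MvPolynomial (Fin (n + 2)) K) {d : ℕ} (hF : F.IsHomogeneous d)
    (hJ : IsNonsingularForm K F) (hd : 0 < d) : Scheme.IsRegular (hypersurface F).left := by
  haveI := smoothOfRelativeDimension_hypersurface_hom F hF hJ hd
  exact fun x => isRegularLocalRing_stalk_of_smoothOfRelativeDimension (hypersurface F).hom n x

/-! ## EL♮ for smooth hypersurfaces, every dimension -/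

/-- **EL♮ HOLDS FOR EVERY SMOOTH HYPERSURFACE, IN EVERY DIMENSION.** For a nonsingular form `F ∈ K[x₀,…,x_{n+1}]` (`n ≥ 1`) of degree
`d ≥ 1` over an algebraically closed field `K` of characteristic `p`, the smooth hypersurface `H = V₊(F) ⊂ ℙⁿ⁺¹_K` (integral by
`IsNonsingularForm.prime`) satisfies `Theorems.EquisingularLift.ELNatAt p K (n + 1) H ι` — the zero-step rung `elNatAt_of_isRegular`.
The first instances of the `∀ n` crux outside `ℙ³`. [OURS · L1 W4.5b] [folklore] -/
theorem elNatAt_smoothHypersurface (p : ℕ) (hp : p.Prime) (K : Type) [Field K] [CharP K p] [IsAlgClosed K] {n : ℕ} (hn : 1 ≤ n)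
    (F : MvPolynomial (Fin (n + 2)) K) {d : ℕ} (hF : F.IsHomogeneous d) (hd : 1 ≤ d) (hJ : IsNonsingularForm K F) :
    Theorems.EquisingularLift.ELNatAt p K (n + 1) (hypersurface F).left (hypersurfaceι F).left := by
  haveI := isIntegral_hypersurface_of_prime K F hF (hJ.prime hn hd hF)
  exact elNatAt_of_isRegular p hp K (n + 1) _ _ (isRegular_hypersurface_of_isNonsingularForm K F hF hJ hd)

/-- **Instance: the FERMAT HYPERSURFACES of every dimension** `x₀ᵈ + ⋯ + x_{n+1}ᵈ = 0` in `ℙⁿ⁺¹_K`, `n ≥ 1`, `p ∤ d` (tree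
`isNonsingularForm_sum_X_pow`). [folklore] -/
theorem elNatAt_fermatHypersurface (p : ℕ) (hp : p.Prime) (K : Type) [Field K] [CharP K p] [IsAlgClosed K] {n : ℕ} (hn : 1 ≤ n)
    (d : ℕ) (hdK : (d : K) ≠ 0) :
    Theorems.EquisingularLift.ELNatAt p K (n + 1)
      (hypersurface (∑ i : Fin (n + 2), (X i : MvPolynomial (Fin (n + 2)) K) ^ d)).left
      (hypersurfaceι (∑ i : Fin (n + 2), (X i : MvPolynomial (Fin (n + 2)) K) ^ d)).left := by
  have hd : 1 ≤ d := Nat.one_le_iff_ne_zero.mpr (by rintro rfl; exact hdK (by simp))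
  have hF : (∑ i : Fin (n + 2), (X i : MvPolynomial (Fin (n + 2)) K) ^ d).IsHomogeneous d :=
    IsHomogeneous.sum _ _ _ fun i _ => by simpa using (isHomogeneous_X K i).pow d
  exact elNatAt_smoothHypersurface p hp K hn _ hF hd (isNonsingularForm_sum_X_pow hdK)

/-- **Instance: smooth PLANE CURVES** (`n = 1`): every nonsingular plane form `G` of degree `≥ 1` gives `ELNatAt p K 2 V₊(G) ι`. [folklore] -/
theorem elNatAt_smoothPlaneCurve (p : ℕ) (hp : p.Prime) (K : Type) [Field K] [CharP K p] [IsAlgClosed K]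
    (G : MvPolynomial (Fin 3) K) {d : ℕ} (hG : G.IsHomogeneous d) (hd : 1 ≤ d) (hJ : IsNonsingularForm K G) :
    Theorems.EquisingularLift.ELNatAt p K 2 (hypersurface G).left (hypersurfaceι G).left :=
  elNatAt_smoothHypersurface p hp K le_rfl G hG hd hJ

end HypersurfaceSpecimen

end Summit.ResolutionOfSingularities.ResolutionOfSingularities.Cruxes.EquisingularLiftNat.Sections

end
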